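/-
Copyright (c) 2026 the pub-hodgecm-mathlib formalisation cell (harness21).  Prover seat hodgecm-mathlib-K2E3-p03 (g9) (E3 hand at the L1 valve, LEAD F0P6-plan (g14)
BATCH #92 (2) «VALVE DEAL → K2E3-p03: `Theorems/K2LiuIncoherentKindWLetters.lean` — the `hW` block of the (S5-c) head BY VALUE for the incoherent family `g_{S,G}`,
hypothesis-first on (x-b)'s three global letters»; desk K2E4-p10 (g9)): Track B «K2-LIT», hLiu418 = stmt-HodgeConjecture-24832, road `K2_Liu`, socket #42S, organ S5,
KIND W of the incoherent family.  2026-09-04.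
-/
import Summits.HodgeConjecture.HodgeConjecture.Theorems.K2LiuSiegelEisensteinWhittakerFactorLetters  -- ★ `exists_whittaker_factorLetters_of_weightLetters` (KIND W from the weight letters)
import Summits.HodgeConjecture.HodgeConjecture.Theorems.K2LiuSiegelEisensteinKindWInstance           -- ★ p862446 (K2E4-p10 (g9)) §1.3 `hsupp_of_local`
import Summits.HodgeConjecture.HodgeConjecture.Theorems.K2LiuSiegelEisensteinKindWDecay              -- ★ p862527 (K2E4-p10 (g9)) `hdec_of_letters`
import Literature.NumberTheory.GelbartRogawski1991.DoubledWeilRepresentationDetTwist                  -- ★ `detChar` (the det-twist of `g_{S,G}`)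
import Literature.NumberTheory.K2Lit.SiegelStandardExtension                                         -- ★ `stdExtension`, `IwasawaDatum`
import HarnessLib

/-!
# Crux `HLiu418`, road `K2_Liu`, socket #42S, organ S5 — `K2LiuIncoherentKindWLetters`: THE KIND-W PACKAGE `hW` OF THE INCOHERENT FAMILY `g_{S,G}`
# FROM (x-b)'s THREE GLOBAL LETTERS (S-loc) (D-loc) (hdet0) — hypothesis-first, pure plumbing

Cell `hodgecm-mathlib`, crux item hLiu418 = `stmt-HodgeConjecture-24832` (helper lane `--supports stmt-HodgeConjecture-24832 --as helper`, count-neutral), route of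
record `HCCMUnconditional`; squad K2 ∕ K2Liu (L1, LEAD F0P6-plan (g14) BATCH #92 (2)); prover K2E3-p03 (g9) (E3 hand at the valve); desk K2E4-p10 (g9).  THEOREMS ONLY
(no `def`, no `instance`, no notation, no named-fact hypothesis, no `sorry`).

THE POINT.  ★ S5 OF RECORD ED. 4 `K2LiuIncoherentZeroResidueOfRecordEdFour.incoherentFamily_firstTerm_zero_of_packages₄` (p862549) consumes KIND W of the incoherent family
`g_{S,G} := (α ∘ det) · stdExtension 𝒦 ((3 − n)∕2) G` as ONE package over the carrier (its binder `hW`, tree :203–213 = ★ ed. 9's bytes at `f := g_{S,G}`):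
  `∀ [MeasurableSpace N_Δ] [BorelSpace N_Δ] (νN) [νN.IsHaarMeasure], ∃ WT GW w, hWTd ∧ hGWd ∧ hw0 ∧ hws ∧ hg ∧ hRKW`.
The KIND-W organ pays it in two stages: ★ `K2LiuSiegelEisensteinWhittakerFactorLetters.exists_whittaker_factorLetters_of_weightLetters` (F0P2-p08 ∕ K2E4-p10) turns the EULER
DATA `(A, U, hEuler, hAd)` and the three WEIGHT LETTERS `(τ, hτ)`, `hdec`, `(C_W, κ, hsupp)` into `∃ WT GW w, …`; and (x-b) (K2E4-p10 (g9)) turns PER-PLACE letters into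
the weight letters — ★ `K2LiuSiegelEisensteinKindWInstance.hsupp_of_local` ((S-loc) ⟹ `hsupp`) and ★ `K2LiuSiegelEisensteinKindWDecay.hdec_of_letters` ((D-loc) + (hdet0) +
`hsupp` ⟹ `hdec`, the archimedean determinant defect absorbed by arithmetic).  THIS FILE is the plumbing between them, stated HYPOTHESIS-FIRST on (x-b)'s three global
letters (K2E4-p10 (g9), K2 bus 2026-09-04T22:31:26Z, bytes of ★ `hsupp_of_local` ∕ `hdec_of_letters` read at `mat := (↑)`, `ht := (↑)`, `N := n + n`):
  (S-loc) `∀ S s h, 0 < re s → A S s h ≠ 0 → ∀ w, ∃ m, N𝔭_w^m ≤ N𝔭_w^{δ w} · H_w(h)^k ∧ ∀ a b, |S_{ab}|_w ≤ q_w^m` (for some finite defect datum `(T_δ, δ)`, `k`);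
  (hdet0) `det S = 0 → A S s h = 0`;  (D-loc) the TOP's decay shape TIMES `∏_{w∣∞} (1 + |det S|_w⁻¹)^{N′}` (for some `N₁ N′`).
* §1 **`kindW_package_of_globalLetters`** — carrier-FIXED, family-GENERIC (`f`, any measure `νN` on `N_Δ(𝔸)`, frame `e : Fin N × Fin M ≃ Fin n`, `0 < n`): Euler data +
  `(τ, hτ)` + (S-loc) + (hdet0) + (D-loc) ⟹ `∃ WT GW w, ‹the six KIND-W conjuncts›` (★ `hsupp_of_local` → ★ `hdec_of_letters` → ★ `exists_whittaker_factorLetters_of_weightLetters`).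
* §2 **`incoherentFamily_kindW_package`** — §1 READ AT `f := g_{S,G}` (`e : Fin 2 × Fin 1 ≃ Fin n`) UNDER THE CARRIER PREFIX: from
  `∀ carrier, ∃ A U τ T_δ δ k N₁ N′, hEuler ∧ hAd ∧ hτ ∧ hδ ∧ (S-loc) ∧ (hdet0) ∧ (D-loc)` to ★ ED. 4's `hW` BYTES VERBATIM (tree :203–213).
[MoeglinWaldspurger1995, II.1.7, IV.1.9]; [Shimura1997, §18.4 Prop. 18.14]; [KudlaRallis1994, §1–§2]; [Tan1999, §4 Prop. 4.8]; [BorelJacquet1979, §1.2].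
HONEST LABEL.  Count-neutral helper, closes no socket: `HC_CM` is proved only modulo the 7 printed citations (2 remaining named inputs: hLiu418 =
`stmt-HodgeConjecture-24832`, h413 = `stmt-HodgeConjecture-24833`) until rung 0 closes.
-/

set_option autoImplicit false
set_option linter.dupNamespace false -- the mandated namespace repeats `HodgeConjecture.HodgeConjecture`

noncomputable section

open scoped Matrix ENNReal NNReal
open NumberField IsDedekindDomain MeasureTheory
open Literature.NumberTheory.Automorphic Literature.NumberTheory.GaloisRepresentations Literature.NumberTheory.LFunctions
open Literature.NumberTheory.GelbartRogawski1991 Literature.NumberTheory.GelbartRogawski1991.GRConstruction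
open Literature.NumberTheory.GelbartRogawski1991.GRConstruction.DoubledWeilDetTwist
open Literature.NumberTheory.K2Lit.SiegelDoubled

namespace Summit.HodgeConjecture.HodgeConjecture.Cruxes.HLiu418.K2LiuIncoherentKindWLetters

open K2LiuSiegelUnipotentFourierDefs
open K2LiuSiegelEisensteinWhittakerFactorLetters (exists_whittaker_factorLetters_of_weightLetters)
open K2LiuSiegelEisensteinKindWInstance (hsupp_of_local)
open K2LiuSiegelEisensteinKindWDecay (hdec_of_letters)

/-! ## §1 Carrier-fixed, family-generic: the KIND-W package from the Euler data and (x-b)'s three global letters -/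

open scoped Classical in -- `Fintype {w // IsReal w}` etc. inside `mixedSpace L` (as in ★ `exists_whittaker_factorLetters_of_weightLetters`' `hτ`)
/-- **KIND W FROM (x-b)'s THREE GLOBAL LETTERS (carrier-fixed, family-generic).**  For a family `f`, a measure `νN` on `N_Δ(𝔸)`, the EULER DATA `(A, U, hEuler, hAd)`
(★ `K2LiuSiegelEisensteinWhittakerFactorLetters`), an archimedean size `(τ, hτ)` of the index, and K2E4-p10 (g9)'s three global letters on the `T`-part `A` —
(S-loc) per-place lattice letters with a finite defect datum `(T_δ, δ)` and exponent `k`, (hdet0) `A = 0` at the degenerate indices, (D-loc) the local decay letter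
carrying the archimedean determinant defect `∏_{w∣∞} (1 + |det S|_w⁻¹)^{N′}` — the TOP's KIND-W package `∃ WT GW w, hWTd ∧ hGWd ∧ hw0 ∧ hws ∧ hg ∧ hRKW` (★ ed. 9's
bytes at `(f, νN)`): (S-loc) ⟹ `hsupp` (★ `hsupp_of_local`, `mat := (↑)`, `ht := (↑)`, `N := n + n`), then (D-loc) + (hdet0) + `hsupp` ⟹ `hdec` (★ `hdec_of_letters`),
then ★ `exists_whittaker_factorLetters_of_weightLetters`. [cite: MoeglinWaldspurger1995, II.1.7, IV.1.9] [cite: Shimura1997, §18.4 Prop. 18.14]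
[cite: KudlaRallis1994, §1–§2] [cite: Tan1999, §4 Prop. 4.8] [cite: BorelJacquet1979, §1.2] -/
theorem kindW_package_of_globalLetters
    (L : Type) [Field L] [NumberField L] [IsCMField L] {N M n : ℕ} (hn : 0 < n) (e : Fin N × Fin M ≃ Fin n)
    (dV : Fin N → L) (hdV : ∀ i, IsCMField.complexConj L (dV i) = dV i)
    (dW : Fin M → L) (hdW : ∀ i, IsCMField.complexConj L (dW i) = dW i)
    (f : ℂ → HA L e dV hdV dW hdW → ℂ)
    [MeasurableSpace (unipDelta L e dV hdV dW hdW)] (νN : Measure (unipDelta L e dV hdV dW hdW))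
    -- the EULER DATA by value ((W1)+(W2))
    (A : skewMatrices ((IsCMField.complexConj L : L ≃ₐ[Fp L] L) : L →+* L) ((gramR L e dV hdV dW hdW).map (algebraMap (Fp L) L)) → ℂ → HA L e dV hdV dW hdW → ℂ)
    (U : skewMatrices ((IsCMField.complexConj L : L ≃ₐ[Fp L] L) : L →+* L) ((gramR L e dV hdV dW hdW).map (algebraMap (Fp L) L)) → HA L e dV hdV dW hdW →
      Set (HeightOneSpectrum (𝓞 ↥(maximalRealSubfield L))))
    (hEuler : ∀ S : skewMatrices ((IsCMField.complexConj L : L ≃ₐ[Fp L] L) : L →+* L) ((gramR L e dV hdV dW hdW).map (algebraMap (Fp L) L)),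
      (S : Matrix (Fin n) (Fin n) L).det ≠ 0 → ∀ (s : ℂ) (h : HA L e dV hdV dW hdW), (n : ℝ) / 2 < s.re →
        whittakerDelta L e dV hdV dW hdW νN (S : Matrix (Fin n) (Fin n) L) (f s) h =
          A S s h * (partialStandardL (U S h) (fun _ => {1}) (2 * s + 1) *
            partialStandardL (U S h) (fun v => {(quadraticHeckeCharCM L).valueAtUniformizer v}) (2 * s + 2))⁻¹)
    (hAd : ∀ S (h : HA L e dV hdV dW hdW), DifferentiableOn ℂ (fun s => A S s h) {s : ℂ | 0 < s.re})
    -- the archimedean size of the index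
    (τ : skewMatrices ((IsCMField.complexConj L : L ≃ₐ[Fp L] L) : L →+* L) ((gramR L e dV hdV dW hdW).map (algebraMap (Fp L) L)) → ℝ)
    (hτ : ∀ S : skewMatrices ((IsCMField.complexConj L : L ≃ₐ[Fp L] L) : L →+* L) ((gramR L e dV hdV dW hdW).map (algebraMap (Fp L) L)),
      ‖(fun i j => NumberField.mixedEmbedding L ((S : Matrix (Fin n) (Fin n) L) i j))‖ ≤ τ S)
    -- (x-b)'s THREE GLOBAL LETTERS: (S-loc) with its defect datum, (hdet0), (D-loc) with its exponents
    (Tδ : Finset (HeightOneSpectrum (𝓞 L))) (δ : HeightOneSpectrum (𝓞 L) → ℕ) (hδ : ∀ w ∉ Tδ, δ w = 0) (k : ℕ)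
    (hSloc : ∀ (S : skewMatrices ((IsCMField.complexConj L : L ≃ₐ[Fp L] L) : L →+* L) ((gramR L e dV hdV dW hdW).map (algebraMap (Fp L) L))) (s : ℂ) (h : HA L e dV hdV dW hdW), 0 < s.re → A S s h ≠ 0 →
      ∀ w : HeightOneSpectrum (𝓞 L), ∃ m : ℕ,
        ((Ideal.absNorm w.asIdeal : ℕ) : ℝ) ^ m ≤ ((Ideal.absNorm w.asIdeal : ℕ) : ℝ) ^ δ w * (GLn.localHeight (n + n) L w (h : GL (Fin (n + n)) (AdeleRing (𝓞 L) L)) : ℝ) ^ k ∧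
          ∀ a b, Valued.v ((((S : Matrix (Fin n) (Fin n) L) a b : L)) : w.adicCompletion L) ≤ WithZero.exp (m : ℤ))
    (hdet0 : ∀ (S : skewMatrices ((IsCMField.complexConj L : L ≃ₐ[Fp L] L) : L →+* L) ((gramR L e dV hdV dW hdW).map (algebraMap (Fp L) L))) (s : ℂ) (h : HA L e dV hdV dW hdW), (S : Matrix (Fin n) (Fin n) L).det = 0 → A S s h = 0)
    (N₁ N' : ℕ)
    (hDloc : ∀ z : ℂ, 0 < z.re → ∃ C a c a' r : ℝ, 0 ≤ C ∧ 0 ≤ a ∧ 0 < c ∧ 0 ≤ a' ∧ 0 < r ∧ ∀ (S : skewMatrices ((IsCMField.complexConj L : L ≃ₐ[Fp L] L) : L →+* L) ((gramR L e dV hdV dW hdW).map (algebraMap (Fp L) L))) (s : ℂ), dist s z < r → ∀ h : HA L e dV hdV dW hdW,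
      ‖A S s h‖ ≤ C * adelicHeightGL (n + n) L (h : GL (Fin (n + n)) (AdeleRing (𝓞 L) L)) ^ a *
        (Real.exp (-(c * adelicHeightGL (n + n) L (h : GL (Fin (n + n)) (AdeleRing (𝓞 L) L)) ^ (-a') * τ S)) * (1 + τ S) ^ N₁) *
          ∏ w : InfinitePlace L, (1 + (w (S : Matrix (Fin n) (Fin n) L).det)⁻¹) ^ N') :
    ∃ (WT GW : skewMatrices ((IsCMField.complexConj L : L ≃ₐ[Fp L] L) : L →+* L) ((gramR L e dV hdV dW hdW).map (algebraMap (Fp L) L)) → ℂ → HA L e dV hdV dW hdW → ℂ) (w : skewMatrices ((IsCMField.complexConj L : L ≃ₐ[Fp L] L) : L →+* L) ((gramR L e dV hdV dW hdW).map (algebraMap (Fp L) L)) → ℝ),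
        (∀ S (h : HA L e dV hdV dW hdW), DifferentiableOn ℂ (fun s => WT S s h) {s : ℂ | 0 < s.re}) ∧
        (∀ S (h : HA L e dV hdV dW hdW), DifferentiableOn ℂ (fun s => GW S s h) {s : ℂ | 0 < s.re}) ∧
        (∀ S, 0 ≤ w S) ∧
        (Summable w) ∧
        (∀ z : ℂ, 0 < z.re → ∃ C A r : ℝ, 0 ≤ C ∧ 0 ≤ A ∧ 0 < r ∧ ∀ S (s : ℂ), dist s z < r → ∀ h : HA L e dV hdV dW hdW,
      ‖WT S s h * GW S s h‖ ≤ C * w S * adelicHeightGL (n + n) L (h : GL (Fin (n + n)) (AdeleRing (𝓞 L) L)) ^ A) ∧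
        (∀ S : skewMatrices ((IsCMField.complexConj L : L ≃ₐ[Fp L] L) : L →+* L) ((gramR L e dV hdV dW hdW).map (algebraMap (Fp L) L)),
      (S : Matrix (Fin n) (Fin n) L).det ≠ 0 → ∀ (s : ℂ) (h : HA L e dV hdV dW hdW), (n : ℝ) / 2 < s.re →
        whittakerDelta L e dV hdV dW hdW νN (S : Matrix (Fin n) (Fin n) L) (f s) h = WT S s h * GW S s h) := by
  haveI : NeZero (n + n) := ⟨by omega⟩
  -- (S-loc) ⟹ the SUPPORT letter `hsupp` of the TOP (★ `hsupp_of_local` at `mat := (↑)`, `ht := (↑)`, `N := n + n`)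
  obtain ⟨CW, κ, hCW, hκ, hsupp⟩ := hsupp_of_local L (fun S : skewMatrices ((IsCMField.complexConj L : L ≃ₐ[Fp L] L) : L →+* L) ((gramR L e dV hdV dW hdW).map (algebraMap (Fp L) L)) => (S : Matrix (Fin n) (Fin n) L))
    (fun h : HA L e dV hdV dW hdW => (h : GL (Fin (n + n)) (AdeleRing (𝓞 L) L))) A Tδ δ hδ k hSloc
  -- (D-loc) + (hdet0) + `hsupp` ⟹ the DECAY letter `hdec` of the TOP (★ `hdec_of_letters`: the archimedean determinant defect is absorbed)
  obtain ⟨NW, hdec⟩ := hdec_of_letters L (fun S : skewMatrices ((IsCMField.complexConj L : L ≃ₐ[Fp L] L) : L →+* L) ((gramR L e dV hdV dW hdW).map (algebraMap (Fp L) L)) => (S : Matrix (Fin n) (Fin n) L))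
    (fun h : HA L e dV hdV dW hdW => (h : GL (Fin (n + n)) (AdeleRing (𝓞 L) L))) A τ hτ hdet0 hCW hκ hsupp N₁ N' hDloc
  -- the weight letters ⟹ KIND W (★ `exists_whittaker_factorLetters_of_weightLetters`)
  exact exists_whittaker_factorLetters_of_weightLetters L hn e dV hdV dW hdW f νN A U hEuler hAd τ hτ NW hdec hCW hκ hsupp

/-! ## §2 The incoherent family `g_{S,G}` under the carrier prefix: ★ S5 ED. 4's `hW` bytes verbatim -/

open scoped Classical in -- as §1
/-- **THE KIND-W PACKAGE `hW` OF THE INCOHERENT FAMILY `g_{S,G} = (α ∘ det) · stdExtension 𝒦 ((3 − n)∕2) G`** in ★ S5 OF RECORD ED. 4's bytes (tree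
`K2LiuIncoherentZeroResidueOfRecordEdFour.lean` :203–213): IF at EVERY carrier `(N_Δ(𝔸), Borel, νN Haar)` the KIND-W organ supplies the Euler data `(A, U, hEuler, hAd)` of
`g_{S,G}`, an archimedean size `(τ, hτ)` and (x-b)'s three global letters (S-loc) (with `(T_δ, δ, k)`), (hdet0), (D-loc) (with `N₁, N′`) for that `A` — ONE ∃-hypothesis over
the carrier — THEN `hW` holds: `∀ carrier, ∃ WT GW w, hWTd ∧ hGWd ∧ hw0 ∧ hws ∧ hg ∧ hRKW` (§1 at `f := g_{S,G}`; `0 < n` from `e : Fin 2 × Fin 1 ≃ Fin n`).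
[cite: MoeglinWaldspurger1995, II.1.7, IV.1.9] [cite: Shimura1997, §18.4 Prop. 18.14] [cite: KudlaRallis1994, §1–§2] [cite: Tan1999, §4 Prop. 4.8] -/
theorem incoherentFamily_kindW_package
    (L : Type) [Field L] [NumberField L] [IsCMField L] {n : ℕ} (e : Fin 2 × Fin 1 ≃ Fin n)
    (dV : Fin 2 → L) (hdV : ∀ i, IsCMField.complexConj L (dV i) = dV i) (hdV0 : ∀ i, dV i ≠ 0)
    (dW : Fin 1 → L) (hdW : ∀ i, IsCMField.complexConj L (dW i) = dW i) (hdW0 : ∀ i, dW i ≠ 0)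
    (𝒦 : IwasawaDatum L e dV hdV dW hdW)
    (α : UnitaryGroup.adelicOne (Fp L) L (IsCMField.complexConj L) →* ℂˣ)
    (G : HA L e dV hdV dW hdW → ℂ)
    (hx : ∀ [MeasurableSpace (unipDelta L e dV hdV dW hdW)] [BorelSpace (unipDelta L e dV hdV dW hdW)] (νN : Measure (unipDelta L e dV hdV dW hdW)) [νN.IsHaarMeasure],
      ∃ (A : skewMatrices ((IsCMField.complexConj L : L ≃ₐ[Fp L] L) : L →+* L) ((gramR L e dV hdV dW hdW).map (algebraMap (Fp L) L)) → ℂ → HA L e dV hdV dW hdW → ℂ)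
        (U : skewMatrices ((IsCMField.complexConj L : L ≃ₐ[Fp L] L) : L →+* L) ((gramR L e dV hdV dW hdW).map (algebraMap (Fp L) L)) → HA L e dV hdV dW hdW → Set (HeightOneSpectrum (𝓞 ↥(maximalRealSubfield L))))
        (τ : skewMatrices ((IsCMField.complexConj L : L ≃ₐ[Fp L] L) : L →+* L) ((gramR L e dV hdV dW hdW).map (algebraMap (Fp L) L)) → ℝ)
        (Tδ : Finset (HeightOneSpectrum (𝓞 L))) (δ : HeightOneSpectrum (𝓞 L) → ℕ) (k N₁ N' : ℕ),
      (∀ S : skewMatrices ((IsCMField.complexConj L : L ≃ₐ[Fp L] L) : L →+* L) ((gramR L e dV hdV dW hdW).map (algebraMap (Fp L) L)),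
      (S : Matrix (Fin n) (Fin n) L).det ≠ 0 → ∀ (s : ℂ) (h : HA L e dV hdV dW hdW), (n : ℝ) / 2 < s.re →
        whittakerDelta L e dV hdV dW hdW νN (S : Matrix (Fin n) (Fin n) L) ((fun s h => ((detChar L e dV hdV hdV0 dW hdW hdW0 α h : ℂˣ) : ℂ) * stdExtension 𝒦 ((((3 : ℕ) : ℂ) - (n : ℂ)) / 2) G s h) s) h =
          A S s h * (partialStandardL (U S h) (fun _ => {1}) (2 * s + 1) *
            partialStandardL (U S h) (fun v => {(quadraticHeckeCharCM L).valueAtUniformizer v}) (2 * s + 2))⁻¹) ∧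
      (∀ S (h : HA L e dV hdV dW hdW), DifferentiableOn ℂ (fun s => A S s h) {s : ℂ | 0 < s.re}) ∧
      (∀ S : skewMatrices ((IsCMField.complexConj L : L ≃ₐ[Fp L] L) : L →+* L) ((gramR L e dV hdV dW hdW).map (algebraMap (Fp L) L)),
      ‖(fun i j => NumberField.mixedEmbedding L ((S : Matrix (Fin n) (Fin n) L) i j))‖ ≤ τ S) ∧
      (∀ w ∉ Tδ, δ w = 0) ∧
      (∀ (S : skewMatrices ((IsCMField.complexConj L : L ≃ₐ[Fp L] L) : L →+* L) ((gramR L e dV hdV dW hdW).map (algebraMap (Fp L) L))) (s : ℂ) (h : HA L e dV hdV dW hdW), 0 < s.re → A S s h ≠ 0 →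
      ∀ w : HeightOneSpectrum (𝓞 L), ∃ m : ℕ,
        ((Ideal.absNorm w.asIdeal : ℕ) : ℝ) ^ m ≤ ((Ideal.absNorm w.asIdeal : ℕ) : ℝ) ^ δ w * (GLn.localHeight (n + n) L w (h : GL (Fin (n + n)) (AdeleRing (𝓞 L) L)) : ℝ) ^ k ∧
          ∀ a b, Valued.v ((((S : Matrix (Fin n) (Fin n) L) a b : L)) : w.adicCompletion L) ≤ WithZero.exp (m : ℤ)) ∧
      (∀ (S : skewMatrices ((IsCMField.complexConj L : L ≃ₐ[Fp L] L) : L →+* L) ((gramR L e dV hdV dW hdW).map (algebraMap (Fp L) L))) (s : ℂ) (h : HA L e dV hdV dW hdW), (S : Matrix (Fin n) (Fin n) L).det = 0 → A S s h = 0) ∧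
      (∀ z : ℂ, 0 < z.re → ∃ C a c a' r : ℝ, 0 ≤ C ∧ 0 ≤ a ∧ 0 < c ∧ 0 ≤ a' ∧ 0 < r ∧ ∀ (S : skewMatrices ((IsCMField.complexConj L : L ≃ₐ[Fp L] L) : L →+* L) ((gramR L e dV hdV dW hdW).map (algebraMap (Fp L) L))) (s : ℂ), dist s z < r → ∀ h : HA L e dV hdV dW hdW,
      ‖A S s h‖ ≤ C * adelicHeightGL (n + n) L (h : GL (Fin (n + n)) (AdeleRing (𝓞 L) L)) ^ a *
        (Real.exp (-(c * adelicHeightGL (n + n) L (h : GL (Fin (n + n)) (AdeleRing (𝓞 L) L)) ^ (-a') * τ S)) * (1 + τ S) ^ N₁) *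
          ∏ w : InfinitePlace L, (1 + (w (S : Matrix (Fin n) (Fin n) L).det)⁻¹) ^ N')) :
    ∀ [MeasurableSpace (unipDelta L e dV hdV dW hdW)] [BorelSpace (unipDelta L e dV hdV dW hdW)] (νN : Measure (unipDelta L e dV hdV dW hdW)) [νN.IsHaarMeasure],
        ∃ (WT GW : skewMatrices ((IsCMField.complexConj L : L ≃ₐ[Fp L] L) : L →+* L) ((gramR L e dV hdV dW hdW).map (algebraMap (Fp L) L)) → ℂ → HA L e dV hdV dW hdW → ℂ) (w : skewMatrices ((IsCMField.complexConj L : L ≃ₐ[Fp L] L) : L →+* L) ((gramR L e dV hdV dW hdW).map (algebraMap (Fp L) L)) → ℝ),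
        (∀ S (h : HA L e dV hdV dW hdW), DifferentiableOn ℂ (fun s => WT S s h) {s : ℂ | 0 < s.re}) ∧
        (∀ S (h : HA L e dV hdV dW hdW), DifferentiableOn ℂ (fun s => GW S s h) {s : ℂ | 0 < s.re}) ∧
        (∀ S, 0 ≤ w S) ∧
        (Summable w) ∧
        (∀ z : ℂ, 0 < z.re → ∃ C A r : ℝ, 0 ≤ C ∧ 0 ≤ A ∧ 0 < r ∧ ∀ S (s : ℂ), dist s z < r → ∀ h : HA L e dV hdV dW hdW,
      ‖WT S s h * GW S s h‖ ≤ C * w S * adelicHeightGL (n + n) L (h : GL (Fin (n + n)) (AdeleRing (𝓞 L) L)) ^ A) ∧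
        (∀ S : skewMatrices ((IsCMField.complexConj L : L ≃ₐ[Fp L] L) : L →+* L) ((gramR L e dV hdV dW hdW).map (algebraMap (Fp L) L)),
      (S : Matrix (Fin n) (Fin n) L).det ≠ 0 → ∀ (s : ℂ) (h : HA L e dV hdV dW hdW), (n : ℝ) / 2 < s.re →
        whittakerDelta L e dV hdV dW hdW νN (S : Matrix (Fin n) (Fin n) L) ((fun s h => ((detChar L e dV hdV hdV0 dW hdW hdW0 α h : ℂˣ) : ℂ) * stdExtension 𝒦 ((((3 : ℕ) : ℂ) - (n : ℂ)) / 2) G s h) s) h = WT S s h * GW S s h) := by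
  intro _ _ νN _
  have hn : 0 < n := by
    have h := Fintype.card_congr e
    simp only [Fintype.card_prod, Fintype.card_fin] at h
    omega
  obtain ⟨A, U, τ, Tδ, δ, k, N₁, N', hEuler, hAd, hτ, hδ, hSloc, hdet0, hDloc⟩ := hx νN
  exact kindW_package_of_globalLetters L hn e dV hdV dW hdW _ νN A U hEuler hAd τ hτ Tδ δ hδ k hSloc hdet0 N₁ N' hDloc

end Summit.HodgeConjecture.HodgeConjecture.Cruxes.HLiu418.K2LiuIncoherentKindWLetters

end
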